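import Summits.NavierStokesRegularity.OSWSelfSimilar.SheetRLinearisedCoercivity
import HarnessLib

/-!
# SHEET-ℝ frame, linearised operator: the cutoff energy inequality with a FREE diagonal value — a-posteriori bounds for the
# actual weak solution (energy and PIVOT norm) and uniqueness for the SKEW-COUPLED PAIR system (the realified complex resolvent)

HONEST FRAMING (cell ns-blowup GROUP B / zone Z3, cases Z3-SR-CERT (the inverse `B_λ⁻¹`) and Z3-SR-SPEC ((P1): the resolvent
`R(σ) = (A + σ)⁻¹` for COMPLEX `σ`, with the pivot bound `‖ιR(σ)g‖_w ≤ ‖g‖_w / c_w(σ)`); 1-D MODEL certificate frame (viscous gCLM/OSW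
sheet on the line); not Euler/NS; «violates: none — MODEL»). Nothing here asserts that a profile exists; coercivity constants are
HYPOTHESES (or come from the pointwise datum of `SheetRLinearisedCoercivity`).

`SheetRLinearisedUniqueness.cutoff_energy_le` (selfsim g10) tests the HOMOGENEOUS weak equation with `χ_R²u`.  Here the same Gaffney-type
computation is recorded with the diagonal value left free,

  `linForm(χ_R u; χ_R u) ≤ linForm(u; χ_R² u) + C·∫_{R² ≤ ξ²} w u²`      (`linForm_cutoff_le`, `C = M² + 4M/L² + M(D₀ + 2D₁)`),

together with the plateau lower bounds `∫_{ξ²<R²} w u² ≤ ∫ w(χ_R u)²`, `∫_{ξ²<R²} w u₁² ≤ ∫ w(χ_R′u + χ_R u₁)²`, and three consequences: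

* `energy_le_of_weak` — for an energy-class weak solution `u` of `(−∂² + d∂ + V)u = g` (`g ∈ L²_w`) and a `κ`-coercive form:
  **`κ(‖u₁‖²_w + ¼‖u‖²_w) ≤ ‖g‖_w‖u‖_w`** (the energy inequality for the solution itself, which is NOT a compactly supported test);
* `pivot_le_of_weak` — if the form is `c`-coercive in the PIVOT norm on tests (`c‖v‖²_w ≤ linForm(v; v)`; from a pointwise datum by
  `pivot_coercive_of_pointwise`), then **`c‖u‖_w ≤ ‖g‖_w`** — the (P1) bound `‖ιR(σ)‖_{w→w} ≤ 1/c_w(σ)` of Z3-SR-SPEC;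
* `pair_eq_zero_of_weak` — **uniqueness for the skew-coupled pair**: if `(u_R, u_I)` in the energy class solve
  `linForm(u_R; φ) = t∫w u_I φ`, `linForm(u_I; φ) = −t∫w u_R φ` for all compactly supported tests (the homogeneous REALIFIED form of
  the complex equation `(A + s + it)(u_R + iu_I) = 0`, `A = −∂² + d∂ + V` real, the shift `s` inside `V`), and the form is `κ`-coercive,
  then `u_R ≡ 0 ≡ u_I` — the `±t` cross terms cancel when the two cutoff inequalities are added.

Pure calculus; no definition, no named fact.  WHAT THIS IS NOT: not NS; no number of record moves.
-/

noncomputable section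

namespace Summit.NavierStokesRegularity.OSWSelfSimilar
namespace SheetRLinearisedCutoffEnergy

open _root_.MeasureTheory _root_.Set _root_.Filter _root_.Real SheetRWeakProfilePV SheetRWeakToStrong SheetREnergyClass
  SheetRLinearisedTests SheetRLinearisedCutoffEstimates SheetRLinearisedUniqueness SheetRLinearisedCoercivity SheetRTestSpace
open scoped Topology

section Cutoff

variable {L D₀ D₁ V₀ : ℝ} {d V u u₁ : ℝ → ℝ}

/-! ### §1 The cutoff inequality with a free diagonal value, and the plateau lower bounds -/

/-- **The cutoff inequality.** For `u` in the energy class, `R ≥ 1` and `|χ_R′| ≤ M/R`: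
`linForm(χ_R u; χ_R u) ≤ linForm(u; χ_R²u) + (M² + 4M/L² + M(D₀ + 2D₁))·∫_{R² ≤ ξ²} w u²`. [folklore] -/
theorem linForm_cutoff_le (hL : 0 < L) (hdm : AEStronglyMeasurable d volume) (hVm : AEStronglyMeasurable V volume)
    (hD₀ : 0 ≤ D₀) (hD₁ : 0 ≤ D₁) (hd : ∀ ξ, |d ξ| ≤ D₀ + D₁ * |ξ|) (hV : ∀ ξ, |V ξ| ≤ V₀)
    (hu : ∀ x, u x = u 0 + ∫ s in (0 : ℝ)..x, u₁ s) (hu₁m : AEStronglyMeasurable u₁ volume)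
    (h0 : Integrable fun y => (L ^ 2 + y ^ 2) * u y ^ 2) (h1 : Integrable fun y => (L ^ 2 + y ^ 2) * u₁ y ^ 2)
    {M : ℝ} (hM0 : 0 ≤ M) {R : ℝ} (hR : 1 ≤ R) (hM : ∀ ξ : ℝ, |deriv (cutoff R) ξ| ≤ M / R) :
    linForm L d V (fun ξ => cutoff R ξ * u ξ) (fun ξ => deriv (cutoff R) ξ * u ξ + cutoff R ξ * u₁ ξ)
        (fun ξ => cutoff R ξ * u ξ) (fun ξ => deriv (cutoff R) ξ * u ξ + cutoff R ξ * u₁ ξ) ≤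
      linForm L d V u u₁ (fun ξ => cutoff R ξ * (cutoff R ξ * u ξ))
          (fun ξ => deriv (cutoff R) ξ * (cutoff R ξ * u ξ) + cutoff R ξ * (deriv (cutoff R) ξ * u ξ + cutoff R ξ * u₁ ξ)) +
        (M ^ 2 + 4 * M / L ^ 2 + M * (D₀ + 2 * D₁)) * ∫ ξ in {ξ : ℝ | R ^ 2 ≤ ξ ^ 2}, (L ^ 2 + ξ ^ 2) * u ξ ^ 2 := by
  set χ : ℝ → ℝ := cutoff R with hχ
  set χ' : ℝ → ℝ := deriv (cutoff R) with hχ'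
  have hdiag := integrable_diag hL hdm hVm hD₀ hD₁ hd hV hu hu₁m h0 h1 hR hM0 hM
  obtain ⟨-, hcorr_int, hcorr_le⟩ := corr_le hL hdm hD₀ hD₁ hd hu hu₁m h0 h1 hR hM0 hM
  have hident : linForm L d V u u₁ (fun ξ => χ ξ * (χ ξ * u ξ))
      (fun ξ => χ' ξ * (χ ξ * u ξ) + χ ξ * (χ' ξ * u ξ + χ ξ * u₁ ξ)) =
      linForm L d V (fun ξ => χ ξ * u ξ) (fun ξ => χ' ξ * u ξ + χ ξ * u₁ ξ) (fun ξ => χ ξ * u ξ)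
        (fun ξ => χ' ξ * u ξ + χ ξ * u₁ ξ) -
      ∫ ξ, ((L ^ 2 + ξ ^ 2) * χ' ξ ^ 2 + 2 * ξ * (χ ξ * χ' ξ) + (L ^ 2 + ξ ^ 2) * d ξ * (χ ξ * χ' ξ)) * u ξ ^ 2 := by
    simp only [linForm]
    rw [← integral_sub hdiag hcorr_int]
    refine integral_congr_ae (Eventually.of_forall fun ξ => ?_)
    exact integrand_cutoff_identity L d V u u₁ χ χ' ξ
  linarith

/-- **Plateau lower bound for the mass**: `∫_{ξ² < R²} w u² ≤ ∫ w (χ_R u)²` (`R > 0`; `u` continuous with `∫ w u² < ∞`). [folklore] -/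
theorem plateau_mass_le {R : ℝ} (hR : 0 < R) (huc : Continuous u) (h0 : Integrable fun y => (L ^ 2 + y ^ 2) * u y ^ 2) :
    Integrable (fun ξ => (L ^ 2 + ξ ^ 2) * (cutoff R ξ * u ξ) ^ 2) ∧
      ∫ ξ in {ξ : ℝ | R ^ 2 ≤ ξ ^ 2}ᶜ, (L ^ 2 + ξ ^ 2) * u ξ ^ 2 ≤ ∫ ξ, (L ^ 2 + ξ ^ 2) * (cutoff R ξ * u ξ) ^ 2 := by
  have hmeas : MeasurableSet {ξ : ℝ | R ^ 2 ≤ ξ ^ 2} := measurableSet_le measurable_const (by fun_prop)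
  have hw : ∀ ξ : ℝ, 0 ≤ L ^ 2 + ξ ^ 2 := fun ξ => by positivity
  have hχsq : Integrable fun ξ => (L ^ 2 + ξ ^ 2) * (cutoff R ξ * u ξ) ^ 2 := by
    refine h0.mono' ((by fun_prop : AEStronglyMeasurable (fun ξ : ℝ => L ^ 2 + ξ ^ 2) volume).mul
      ((((contDiff_cutoff R).continuous.mul huc).pow 2).aestronglyMeasurable)) (Eventually.of_forall fun ξ => ?_)
    rw [Real.norm_eq_abs, abs_of_nonneg (by positivity), mul_pow]
    obtain ⟨h0', h1'⟩ := cutoff_nonneg_le_one R ξ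
    have : cutoff R ξ ^ 2 ≤ 1 := by nlinarith
    nlinarith [mul_nonneg (hw ξ) (sq_nonneg (u ξ))]
  refine ⟨hχsq, ?_⟩
  rw [← integral_indicator hmeas.compl]
  refine integral_mono (h0.indicator hmeas.compl) hχsq fun ξ => ?_
  by_cases hξ : ξ ∈ {ξ : ℝ | R ^ 2 ≤ ξ ^ 2}ᶜ
  · rw [indicator_of_mem hξ]
    simp only [mem_compl_iff, mem_setOf_eq, not_le] at hξ
    rw [cutoff_eq_one hR hξ.le, one_mul]
  · rw [indicator_of_notMem hξ]
    positivity

/-- **Plateau lower bound for the derivative part**: `∫_{ξ² < R²} w u₁² ≤ ∫ w (χ_R′u + χ_R u₁)²` whenever the right-hand integrand is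
integrable (`R > 0`). [folklore] -/
theorem plateau_deriv_le {R : ℝ} (hR : 0 < R) (h1 : Integrable fun y => (L ^ 2 + y ^ 2) * u₁ y ^ 2)
    (hint : Integrable fun ξ => (L ^ 2 + ξ ^ 2) * (deriv (cutoff R) ξ * u ξ + cutoff R ξ * u₁ ξ) ^ 2) :
    ∫ ξ in {ξ : ℝ | R ^ 2 ≤ ξ ^ 2}ᶜ, (L ^ 2 + ξ ^ 2) * u₁ ξ ^ 2 ≤
      ∫ ξ, (L ^ 2 + ξ ^ 2) * (deriv (cutoff R) ξ * u ξ + cutoff R ξ * u₁ ξ) ^ 2 := by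
  have hmeas : MeasurableSet {ξ : ℝ | R ^ 2 ≤ ξ ^ 2} := measurableSet_le measurable_const (by fun_prop)
  rw [← integral_indicator hmeas.compl]
  refine integral_mono (h1.indicator hmeas.compl) hint fun ξ => ?_
  by_cases hξ : ξ ∈ {ξ : ℝ | R ^ 2 ≤ ξ ^ 2}ᶜ
  · rw [indicator_of_mem hξ]
    simp only [mem_compl_iff, mem_setOf_eq, not_le] at hξ
    rw [cutoff_eq_one hR hξ.le, deriv_cutoff_eq_zero_of_lt hR hξ, zero_mul, zero_add, one_mul]
  · rw [indicator_of_notMem hξ]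
    positivity

/-- `∫ w (χ_R²u)² ≤ ∫ w u²` (`0 ≤ χ_R ≤ 1`), with integrability and measurability of `χ_R²u`. [folklore] -/
theorem weightedSq_cutoff_sq_mul_le (R : ℝ) (huc : Continuous u) (h0 : Integrable fun y => (L ^ 2 + y ^ 2) * u y ^ 2) :
    AEStronglyMeasurable (fun ξ => cutoff R ξ * (cutoff R ξ * u ξ)) volume ∧
      Integrable (fun ξ => (L ^ 2 + ξ ^ 2) * (cutoff R ξ * (cutoff R ξ * u ξ)) ^ 2) ∧
      ∫ ξ, (L ^ 2 + ξ ^ 2) * (cutoff R ξ * (cutoff R ξ * u ξ)) ^ 2 ≤ ∫ ξ, (L ^ 2 + ξ ^ 2) * u ξ ^ 2 := by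
  have hχc : Continuous (cutoff R) := (contDiff_cutoff R).continuous
  have hm : AEStronglyMeasurable (fun ξ => cutoff R ξ * (cutoff R ξ * u ξ)) volume :=
    (hχc.mul (hχc.mul huc)).aestronglyMeasurable
  have hle : ∀ ξ, (L ^ 2 + ξ ^ 2) * (cutoff R ξ * (cutoff R ξ * u ξ)) ^ 2 ≤ (L ^ 2 + ξ ^ 2) * u ξ ^ 2 := fun ξ => by
    obtain ⟨h0', h1'⟩ := cutoff_nonneg_le_one R ξ
    have hχ2 : cutoff R ξ ^ 2 ≤ 1 := by nlinarith
    have hχ4 : (cutoff R ξ ^ 2) ^ 2 ≤ 1 := by nlinarith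
    have hw : 0 ≤ (L ^ 2 + ξ ^ 2) * u ξ ^ 2 := by positivity
    calc (L ^ 2 + ξ ^ 2) * (cutoff R ξ * (cutoff R ξ * u ξ)) ^ 2 = (cutoff R ξ ^ 2) ^ 2 * ((L ^ 2 + ξ ^ 2) * u ξ ^ 2) := by ring
      _ ≤ 1 * ((L ^ 2 + ξ ^ 2) * u ξ ^ 2) := mul_le_mul_of_nonneg_right hχ4 hw
      _ = _ := one_mul _
  have hint : Integrable (fun ξ => (L ^ 2 + ξ ^ 2) * (cutoff R ξ * (cutoff R ξ * u ξ)) ^ 2) :=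
    h0.mono' ((by fun_prop : AEStronglyMeasurable (fun ξ : ℝ => L ^ 2 + ξ ^ 2) volume).mul (hm.pow 2))
      (Eventually.of_forall fun ξ => by rw [Real.norm_eq_abs, abs_of_nonneg (by positivity)]; exact hle ξ)
  exact ⟨hm, hint, integral_mono hint h0 hle⟩

/-- A continuous `u` with `∫ (L²+ξ²) u² = 0` (`L > 0`) vanishes identically. [folklore] -/
theorem eq_zero_of_weightedSq_eq_zero (hL : 0 < L) (huc : Continuous u) (h0 : Integrable fun y => (L ^ 2 + y ^ 2) * u y ^ 2)
    (hz : ∫ ξ, (L ^ 2 + ξ ^ 2) * u ξ ^ 2 = 0) : ∀ x, u x = 0 := by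
  have hae : (fun ξ => (L ^ 2 + ξ ^ 2) * u ξ ^ 2) =ᵐ[volume] 0 :=
    (integral_eq_zero_iff_of_nonneg (fun ξ => by positivity) h0).1 hz
  have hcont : Continuous fun ξ : ℝ => (L ^ 2 + ξ ^ 2) * u ξ ^ 2 := by fun_prop
  have hzero : (fun ξ => (L ^ 2 + ξ ^ 2) * u ξ ^ 2) = 0 := (hcont.ae_eq_iff_eq volume continuous_const).1 hae
  intro x
  have hx := congrFun hzero x
  simp only [Pi.zero_apply, mul_eq_zero] at hx
  rcases hx with hx | hx
  · exact absurd hx (by positivity)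
  · exact pow_eq_zero_iff two_ne_zero |>.1 hx

/-! ### §2 A-posteriori bounds for the actual weak solution: energy norm and PIVOT norm -/

/-- The data pairing against `χ_R²u` is bounded by `‖g‖_w‖u‖_w`. [folklore] -/
theorem abs_data_cutoff_le (R : ℝ) {g : ℝ → ℝ} (hgm : AEStronglyMeasurable g volume)
    (hg : Integrable fun y => (L ^ 2 + y ^ 2) * g y ^ 2) (huc : Continuous u) (h0 : Integrable fun y => (L ^ 2 + y ^ 2) * u y ^ 2) :
    |∫ y, (L ^ 2 + y ^ 2) * (g y * (cutoff R y * (cutoff R y * u y)))| ≤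
      Real.sqrt (∫ y, (L ^ 2 + y ^ 2) * g y ^ 2) * Real.sqrt (∫ y, (L ^ 2 + y ^ 2) * u y ^ 2) := by
  obtain ⟨hm, hint, hle⟩ := weightedSq_cutoff_sq_mul_le (L := L) R huc h0
  obtain ⟨hi, hb⟩ := integral_weight_abs_mul_le (L := L) hgm hm hg hint
  have h1 : |∫ y, (L ^ 2 + y ^ 2) * (g y * (cutoff R y * (cutoff R y * u y)))| ≤
      ∫ y, (L ^ 2 + y ^ 2) * |g y * (cutoff R y * (cutoff R y * u y))| := by
    rw [← Real.norm_eq_abs]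
    refine (norm_integral_le_integral_norm _).trans (le_of_eq (integral_congr_ae (Eventually.of_forall fun y => ?_)))
    show ‖(L ^ 2 + y ^ 2) * (g y * (cutoff R y * (cutoff R y * u y)))‖ = (L ^ 2 + y ^ 2) * |g y * (cutoff R y * (cutoff R y * u y))|
    rw [Real.norm_eq_abs, abs_mul, abs_of_nonneg (by positivity : (0:ℝ) ≤ L ^ 2 + y ^ 2)]
  refine h1.trans (hb.trans (mul_le_mul_of_nonneg_left (Real.sqrt_le_sqrt hle) (Real.sqrt_nonneg _)))

/-- **Energy inequality for the weak solution itself.** `u` in the odd energy class, `linForm(u; φ) = ∫ w g φ` for every compactly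
supported test, `g ∈ L²_w`, and the form `κ`-coercive on tests (`κ > 0`): `κ(‖u₁‖²_w + ¼‖u‖²_w) ≤ ‖g‖_w‖u‖_w`. [folklore] -/
theorem energy_le_of_weak (hL : 0 < L) (hdm : AEStronglyMeasurable d volume) (hVm : AEStronglyMeasurable V volume)
    (hD₀ : 0 ≤ D₀) (hD₁ : 0 ≤ D₁) (hd : ∀ ξ, |d ξ| ≤ D₀ + D₁ * |ξ|) (hV : ∀ ξ, |V ξ| ≤ V₀) {κ : ℝ} (hκ : 0 < κ)
    (hcoer : ∀ v v₁ : ℝ → ℝ, IsCompactTest v v₁ →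
      κ * ((∫ ξ, (L ^ 2 + ξ ^ 2) * v₁ ξ ^ 2) + 1 / 4 * ∫ ξ, (L ^ 2 + ξ ^ 2) * v ξ ^ 2) ≤ linForm L d V v v₁ v v₁)
    (hu : ∀ x, u x = u 0 + ∫ s in (0 : ℝ)..x, u₁ s) (hodd : ∀ y, u (-y) = -u y) (hu₁m : AEStronglyMeasurable u₁ volume)
    (h0 : Integrable fun y => (L ^ 2 + y ^ 2) * u y ^ 2) (h1 : Integrable fun y => (L ^ 2 + y ^ 2) * u₁ y ^ 2)
    {g : ℝ → ℝ} (hgm : AEStronglyMeasurable g volume) (hg : Integrable fun y => (L ^ 2 + y ^ 2) * g y ^ 2)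
    (hweak : ∀ φ φ₁ : ℝ → ℝ, IsCompactTest φ φ₁ → linForm L d V u u₁ φ φ₁ = ∫ y, (L ^ 2 + y ^ 2) * (g y * φ y)) :
    κ * ((∫ ξ, (L ^ 2 + ξ ^ 2) * u₁ ξ ^ 2) + 1 / 4 * ∫ ξ, (L ^ 2 + ξ ^ 2) * u ξ ^ 2) ≤
      Real.sqrt (∫ y, (L ^ 2 + y ^ 2) * g y ^ 2) * Real.sqrt (∫ y, (L ^ 2 + y ^ 2) * u y ^ 2) := by
  obtain ⟨huc, hu₁2, hu2, -, -⟩ := basic_of_primitive hL hu hu₁m h0 h1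
  obtain ⟨M, hM0, hM⟩ := exists_deriv_cutoff_le
  set C : ℝ := M ^ 2 + 4 * M / L ^ 2 + M * (D₀ + 2 * D₁) with hC
  set I₀ : ℝ := ∫ ξ, (L ^ 2 + ξ ^ 2) * u ξ ^ 2 with hI₀
  set I₁ : ℝ := ∫ ξ, (L ^ 2 + ξ ^ 2) * u₁ ξ ^ 2 with hI₁
  set G : ℝ := Real.sqrt (∫ y, (L ^ 2 + y ^ 2) * g y ^ 2) * Real.sqrt I₀ with hG
  set T₀ : ℕ → ℝ := fun n => ∫ ξ in {ξ : ℝ | ((n : ℝ) + 1) ^ 2 ≤ ξ ^ 2}, (L ^ 2 + ξ ^ 2) * u ξ ^ 2 with hT₀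
  set T₁ : ℕ → ℝ := fun n => ∫ ξ in {ξ : ℝ | ((n : ℝ) + 1) ^ 2 ≤ ξ ^ 2}, (L ^ 2 + ξ ^ 2) * u₁ ξ ^ 2 with hT₁
  have hstep : ∀ n : ℕ, κ * (I₁ + 1 / 4 * I₀) ≤ G + (C * T₀ n + κ * (T₁ n + 1 / 4 * T₀ n)) := by
    intro n
    have hR : (1 : ℝ) ≤ (n : ℝ) + 1 := by
      have : (0 : ℝ) ≤ n := Nat.cast_nonneg n
      linarith
    have hR0 : (0 : ℝ) < (n : ℝ) + 1 := by linarith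
    have hmeas : MeasurableSet {ξ : ℝ | ((n : ℝ) + 1) ^ 2 ≤ ξ ^ 2} := measurableSet_le measurable_const (by fun_prop)
    obtain ⟨htest, -⟩ := isCompactTest_cutoff_mul hR0 hu hodd hu₁2 hu2
    have htest2 := isCompactTest_cutoff_sq_mul hR0 hu hodd hu₁2 hu2
    have hco := hcoer _ _ htest
    have hcut := linForm_cutoff_le hL hdm hVm hD₀ hD₁ hd hV hu hu₁m h0 h1 hM0 hR (hM _ hR0)
    have hw0 := hweak _ _ htest2
    have hdat := abs_data_cutoff_le (L := L) ((n : ℝ) + 1) hgm hg huc h0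
    have hplat0 := (plateau_mass_le (L := L) hR0 huc h0).2
    have hplat1 := plateau_deriv_le (L := L) hR0 h1 (weighted_of_isCompactTest htest).2
    have hs0 : ∫ ξ in {ξ : ℝ | ((n : ℝ) + 1) ^ 2 ≤ ξ ^ 2}ᶜ, (L ^ 2 + ξ ^ 2) * u ξ ^ 2 = I₀ - T₀ n := by
      rw [hI₀, hT₀, ← integral_add_compl hmeas h0]; ring
    have hs1 : ∫ ξ in {ξ : ℝ | ((n : ℝ) + 1) ^ 2 ≤ ξ ^ 2}ᶜ, (L ^ 2 + ξ ^ 2) * u₁ ξ ^ 2 = I₁ - T₁ n := by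
      rw [hI₁, hT₁, ← integral_add_compl hmeas h1]; ring
    rw [hs0] at hplat0
    rw [hs1] at hplat1
    rw [hw0] at hcut
    have hab := le_abs_self (∫ y, (L ^ 2 + y ^ 2) * (g y * (cutoff ((n : ℝ) + 1) y * (cutoff ((n : ℝ) + 1) y * u y))))
    nlinarith [mul_le_mul_of_nonneg_left hplat1 hκ.le, mul_le_mul_of_nonneg_left hplat0 hκ.le]
  have hlim : Tendsto (fun n : ℕ => G + (C * T₀ n + κ * (T₁ n + 1 / 4 * T₀ n))) atTop (𝓝 (G + (C * 0 + κ * (0 + 1 / 4 * 0)))) :=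
    tendsto_const_nhds.add (((tendsto_tail h0).const_mul C).add
      (((tendsto_tail h1).add ((tendsto_tail h0).const_mul (1 / 4))).const_mul κ))
  simp only [mul_zero, add_zero] at hlim
  exact ge_of_tendsto' hlim hstep

/-- **Pivot coercivity from a pointwise datum**: `d ∈ C¹`, `V` bounded measurable and `c·(L²+ξ²) ≤ (L²+ξ²)V − 1 − ξd − ½(L²+ξ²)d′`
pointwise give `c‖v‖²_w ≤ linForm(v; v)` on every compactly supported test. [folklore] -/
theorem pivot_coercive_of_pointwise (L : ℝ) {c : ℝ} (hdC : ContDiff ℝ 1 d) (hVm : AEStronglyMeasurable V volume)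
    (hV : ∀ ξ, |V ξ| ≤ V₀)
    (hpt : ∀ ξ, c * (L ^ 2 + ξ ^ 2) ≤ (L ^ 2 + ξ ^ 2) * V ξ - 1 - ξ * d ξ - 1 / 2 * (L ^ 2 + ξ ^ 2) * deriv d ξ)
    {v v₁ : ℝ → ℝ} (hv : IsCompactTest v v₁) :
    c * ∫ ξ, (L ^ 2 + ξ ^ 2) * v ξ ^ 2 ≤ linForm L d V v v₁ v v₁ := by
  rw [linForm_diag_eq L hdC hVm hV hv]
  obtain ⟨hwv, -⟩ := weighted_of_isCompactTest (L := L) hv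
  have hP : Integrable fun y => ((L ^ 2 + y ^ 2) * V y - 1 - y * d y - 1 / 2 * (L ^ 2 + y ^ 2) * deriv d y) * v y ^ 2 := by
    have h1 : Integrable fun y => (L ^ 2 + y ^ 2) * V y * v y ^ 2 := integrable_weight_potential_mul_sq hVm hV hv
    have hd'c : Continuous (deriv d) := hdC.continuous_deriv le_rfl
    have hdc : Continuous d := hdC.continuous
    have h2 : Integrable fun y => (-1 - y * d y - 1 / 2 * (L ^ 2 + y ^ 2) * deriv d y) * v y ^ 2 :=
      integrable_continuous_mul_sq (by fun_prop) hv
    refine (h1.add h2).congr (Eventually.of_forall fun y => ?_)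
    simp only [Pi.add_apply]; ring
  have hmono : c * ∫ ξ, (L ^ 2 + ξ ^ 2) * v ξ ^ 2 ≤
      ∫ y, ((L ^ 2 + y ^ 2) * V y - 1 - y * d y - 1 / 2 * (L ^ 2 + y ^ 2) * deriv d y) * v y ^ 2 := by
    rw [← integral_const_mul]
    refine integral_mono (hwv.const_mul _) hP fun y => ?_
    have := mul_le_mul_of_nonneg_right (hpt y) (sq_nonneg (v y))
    simpa only [mul_assoc] using this
  have hnn : 0 ≤ ∫ ξ, (L ^ 2 + ξ ^ 2) * v₁ ξ ^ 2 := integral_nonneg fun y => by positivity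
  linarith

/-- **Pivot bound for the weak solution itself** (Z3-SR-SPEC (P1): `‖ιR(σ)g‖_w ≤ ‖g‖_w/c_w(σ)`).  `u` in the odd energy class with
`linForm(u; φ) = ∫ w g φ` on every compactly supported test, `g ∈ L²_w`, and the form `c`-coercive in the PIVOT norm on tests
(`c‖v‖²_w ≤ linForm(v; v)`, `c > 0`): then `c‖u‖_w ≤ ‖g‖_w`. [folklore] -/
theorem pivot_le_of_weak (hL : 0 < L) (hdm : AEStronglyMeasurable d volume) (hVm : AEStronglyMeasurable V volume)
    (hD₀ : 0 ≤ D₀) (hD₁ : 0 ≤ D₁) (hd : ∀ ξ, |d ξ| ≤ D₀ + D₁ * |ξ|) (hV : ∀ ξ, |V ξ| ≤ V₀) {c : ℝ} (hc : 0 < c)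
    (hcoerw : ∀ v v₁ : ℝ → ℝ, IsCompactTest v v₁ → c * ∫ ξ, (L ^ 2 + ξ ^ 2) * v ξ ^ 2 ≤ linForm L d V v v₁ v v₁)
    (hu : ∀ x, u x = u 0 + ∫ s in (0 : ℝ)..x, u₁ s) (hodd : ∀ y, u (-y) = -u y) (hu₁m : AEStronglyMeasurable u₁ volume)
    (h0 : Integrable fun y => (L ^ 2 + y ^ 2) * u y ^ 2) (h1 : Integrable fun y => (L ^ 2 + y ^ 2) * u₁ y ^ 2)
    {g : ℝ → ℝ} (hgm : AEStronglyMeasurable g volume) (hg : Integrable fun y => (L ^ 2 + y ^ 2) * g y ^ 2)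
    (hweak : ∀ φ φ₁ : ℝ → ℝ, IsCompactTest φ φ₁ → linForm L d V u u₁ φ φ₁ = ∫ y, (L ^ 2 + y ^ 2) * (g y * φ y)) :
    c * Real.sqrt (∫ y, (L ^ 2 + y ^ 2) * u y ^ 2) ≤ Real.sqrt (∫ y, (L ^ 2 + y ^ 2) * g y ^ 2) := by
  obtain ⟨huc, hu₁2, hu2, -, -⟩ := basic_of_primitive hL hu hu₁m h0 h1
  obtain ⟨M, hM0, hM⟩ := exists_deriv_cutoff_le
  set C : ℝ := M ^ 2 + 4 * M / L ^ 2 + M * (D₀ + 2 * D₁) with hC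
  set I₀ : ℝ := ∫ ξ, (L ^ 2 + ξ ^ 2) * u ξ ^ 2 with hI₀
  set G : ℝ := Real.sqrt (∫ y, (L ^ 2 + y ^ 2) * g y ^ 2) with hG
  set T₀ : ℕ → ℝ := fun n => ∫ ξ in {ξ : ℝ | ((n : ℝ) + 1) ^ 2 ≤ ξ ^ 2}, (L ^ 2 + ξ ^ 2) * u ξ ^ 2 with hT₀
  have hstep : ∀ n : ℕ, c * I₀ ≤ G * Real.sqrt I₀ + (C + c) * T₀ n := by
    intro n
    have hR : (1 : ℝ) ≤ (n : ℝ) + 1 := by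
      have : (0 : ℝ) ≤ n := Nat.cast_nonneg n
      linarith
    have hR0 : (0 : ℝ) < (n : ℝ) + 1 := by linarith
    have hmeas : MeasurableSet {ξ : ℝ | ((n : ℝ) + 1) ^ 2 ≤ ξ ^ 2} := measurableSet_le measurable_const (by fun_prop)
    obtain ⟨htest, -⟩ := isCompactTest_cutoff_mul hR0 hu hodd hu₁2 hu2
    have htest2 := isCompactTest_cutoff_sq_mul hR0 hu hodd hu₁2 hu2
    have hco := hcoerw _ _ htest
    have hcut := linForm_cutoff_le hL hdm hVm hD₀ hD₁ hd hV hu hu₁m h0 h1 hM0 hR (hM _ hR0)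
    have hw0 := hweak _ _ htest2
    have hdat := abs_data_cutoff_le (L := L) ((n : ℝ) + 1) hgm hg huc h0
    have hplat0 := (plateau_mass_le (L := L) hR0 huc h0).2
    have hs0 : ∫ ξ in {ξ : ℝ | ((n : ℝ) + 1) ^ 2 ≤ ξ ^ 2}ᶜ, (L ^ 2 + ξ ^ 2) * u ξ ^ 2 = I₀ - T₀ n := by
      rw [hI₀, hT₀, ← integral_add_compl hmeas h0]; ring
    rw [hs0] at hplat0
    rw [hw0] at hcut
    have hab := le_abs_self (∫ y, (L ^ 2 + y ^ 2) * (g y * (cutoff ((n : ℝ) + 1) y * (cutoff ((n : ℝ) + 1) y * u y))))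
    nlinarith [mul_le_mul_of_nonneg_left hplat0 hc.le]
  have hlim : Tendsto (fun n : ℕ => G * Real.sqrt I₀ + (C + c) * T₀ n) atTop (𝓝 (G * Real.sqrt I₀ + (C + c) * 0)) :=
    tendsto_const_nhds.add ((tendsto_tail h0).const_mul (C + c))
  rw [mul_zero, add_zero] at hlim
  have hmain : c * I₀ ≤ G * Real.sqrt I₀ := ge_of_tendsto' hlim hstep
  have hI₀nn : 0 ≤ I₀ := integral_nonneg fun ξ => by positivity
  rcases (Real.sqrt_nonneg I₀).eq_or_lt with hz | hpos
  · rw [← hz, mul_zero]; exact Real.sqrt_nonneg _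
  · have h2 : c * Real.sqrt I₀ * Real.sqrt I₀ ≤ G * Real.sqrt I₀ := by
      rw [mul_assoc, Real.mul_self_sqrt hI₀nn]; exact hmain
    exact le_of_mul_le_mul_right h2 hpos

end Cutoff

/-! ### §3 Uniqueness for the skew-coupled pair (the realified complex equation) -/

section Pair

variable {L D₀ D₁ V₀ : ℝ} {d V uR uR₁ uI uI₁ : ℝ → ℝ}

/-- **Uniqueness for the skew-coupled pair system.** `(u_R, u_I)` in the odd energy class with
`linForm(u_R; φ) = t∫ w u_I φ` and `linForm(u_I; φ) = −t∫ w u_R φ` for all compactly supported tests, and the form `κ`-coercive on tests: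
then `u_R ≡ 0` and `u_I ≡ 0` (homogeneous realified form of `(−∂² + d∂ + V + it)(u_R + iu_I) = 0`). [folklore] -/
theorem pair_eq_zero_of_weak (hL : 0 < L) (hdm : AEStronglyMeasurable d volume) (hVm : AEStronglyMeasurable V volume)
    (hD₀ : 0 ≤ D₀) (hD₁ : 0 ≤ D₁) (hd : ∀ ξ, |d ξ| ≤ D₀ + D₁ * |ξ|) (hV : ∀ ξ, |V ξ| ≤ V₀) {κ : ℝ} (hκ : 0 < κ)
    (hcoer : ∀ v v₁ : ℝ → ℝ, IsCompactTest v v₁ →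
      κ * ((∫ ξ, (L ^ 2 + ξ ^ 2) * v₁ ξ ^ 2) + 1 / 4 * ∫ ξ, (L ^ 2 + ξ ^ 2) * v ξ ^ 2) ≤ linForm L d V v v₁ v v₁)
    (huR : ∀ x, uR x = uR 0 + ∫ s in (0 : ℝ)..x, uR₁ s) (hoddR : ∀ y, uR (-y) = -uR y) (huR₁m : AEStronglyMeasurable uR₁ volume)
    (h0R : Integrable fun y => (L ^ 2 + y ^ 2) * uR y ^ 2) (h1R : Integrable fun y => (L ^ 2 + y ^ 2) * uR₁ y ^ 2)
    (huI : ∀ x, uI x = uI 0 + ∫ s in (0 : ℝ)..x, uI₁ s) (hoddI : ∀ y, uI (-y) = -uI y) (huI₁m : AEStronglyMeasurable uI₁ volume)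
    (h0I : Integrable fun y => (L ^ 2 + y ^ 2) * uI y ^ 2) (h1I : Integrable fun y => (L ^ 2 + y ^ 2) * uI₁ y ^ 2) (t : ℝ)
    (hweakR : ∀ φ φ₁ : ℝ → ℝ, IsCompactTest φ φ₁ → linForm L d V uR uR₁ φ φ₁ = t * ∫ y, (L ^ 2 + y ^ 2) * (uI y * φ y))
    (hweakI : ∀ φ φ₁ : ℝ → ℝ, IsCompactTest φ φ₁ → linForm L d V uI uI₁ φ φ₁ = -t * ∫ y, (L ^ 2 + y ^ 2) * (uR y * φ y)) :
    (∀ x, uR x = 0) ∧ ∀ x, uI x = 0 := by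
  obtain ⟨huRc, huR₁2, huR2, -, -⟩ := basic_of_primitive hL huR huR₁m h0R h1R
  obtain ⟨huIc, huI₁2, huI2, -, -⟩ := basic_of_primitive hL huI huI₁m h0I h1I
  obtain ⟨M, hM0, hM⟩ := exists_deriv_cutoff_le
  set C : ℝ := M ^ 2 + 4 * M / L ^ 2 + M * (D₀ + 2 * D₁) with hC
  set IR : ℝ := ∫ ξ, (L ^ 2 + ξ ^ 2) * uR ξ ^ 2 with hIR
  set II : ℝ := ∫ ξ, (L ^ 2 + ξ ^ 2) * uI ξ ^ 2 with hII
  set TR : ℕ → ℝ := fun n => ∫ ξ in {ξ : ℝ | ((n : ℝ) + 1) ^ 2 ≤ ξ ^ 2}, (L ^ 2 + ξ ^ 2) * uR ξ ^ 2 with hTR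
  set TI : ℕ → ℝ := fun n => ∫ ξ in {ξ : ℝ | ((n : ℝ) + 1) ^ 2 ≤ ξ ^ 2}, (L ^ 2 + ξ ^ 2) * uI ξ ^ 2 with hTI
  have hstep : ∀ n : ℕ, κ / 4 * (IR + II) ≤ (κ / 4 + C) * (TR n + TI n) := by
    intro n
    have hR : (1 : ℝ) ≤ (n : ℝ) + 1 := by
      have : (0 : ℝ) ≤ n := Nat.cast_nonneg n
      linarith
    have hR0 : (0 : ℝ) < (n : ℝ) + 1 := by linarith
    have hmeas : MeasurableSet {ξ : ℝ | ((n : ℝ) + 1) ^ 2 ≤ ξ ^ 2} := measurableSet_le measurable_const (by fun_prop)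
    obtain ⟨htR, -⟩ := isCompactTest_cutoff_mul hR0 huR hoddR huR₁2 huR2
    obtain ⟨htI, -⟩ := isCompactTest_cutoff_mul hR0 huI hoddI huI₁2 huI2
    have htR2 := isCompactTest_cutoff_sq_mul hR0 huR hoddR huR₁2 huR2
    have htI2 := isCompactTest_cutoff_sq_mul hR0 huI hoddI huI₁2 huI2
    have hcoR := hcoer _ _ htR
    have hcoI := hcoer _ _ htI
    have hcutR := linForm_cutoff_le hL hdm hVm hD₀ hD₁ hd hV huR huR₁m h0R h1R hM0 hR (hM _ hR0)
    have hcutI := linForm_cutoff_le hL hdm hVm hD₀ hD₁ hd hV huI huI₁m h0I h1I hM0 hR (hM _ hR0)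
    rw [hweakR _ _ htR2] at hcutR
    rw [hweakI _ _ htI2] at hcutI
    -- the cross terms cancel: both data pairings have the same integrand
    have hcross : ∫ y, (L ^ 2 + y ^ 2) * (uI y * (cutoff ((n : ℝ) + 1) y * (cutoff ((n : ℝ) + 1) y * uR y))) =
        ∫ y, (L ^ 2 + y ^ 2) * (uR y * (cutoff ((n : ℝ) + 1) y * (cutoff ((n : ℝ) + 1) y * uI y))) :=
      integral_congr_ae (Eventually.of_forall fun y => by ring)
    rw [hcross] at hcutR
    have hplatR := (plateau_mass_le (L := L) hR0 huRc h0R).2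
    have hplatI := (plateau_mass_le (L := L) hR0 huIc h0I).2
    have hsR : ∫ ξ in {ξ : ℝ | ((n : ℝ) + 1) ^ 2 ≤ ξ ^ 2}ᶜ, (L ^ 2 + ξ ^ 2) * uR ξ ^ 2 = IR - TR n := by
      rw [hIR, hTR, ← integral_add_compl hmeas h0R]; ring
    have hsI : ∫ ξ in {ξ : ℝ | ((n : ℝ) + 1) ^ 2 ≤ ξ ^ 2}ᶜ, (L ^ 2 + ξ ^ 2) * uI ξ ^ 2 = II - TI n := by
      rw [hII, hTI, ← integral_add_compl hmeas h0I]; ring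
    rw [hsR] at hplatR
    rw [hsI] at hplatI
    have hnnR : 0 ≤ ∫ ξ, (L ^ 2 + ξ ^ 2) *
        (deriv (cutoff ((n : ℝ) + 1)) ξ * uR ξ + cutoff ((n : ℝ) + 1) ξ * uR₁ ξ) ^ 2 := integral_nonneg fun ξ => by positivity
    have hnnI : 0 ≤ ∫ ξ, (L ^ 2 + ξ ^ 2) *
        (deriv (cutoff ((n : ℝ) + 1)) ξ * uI ξ + cutoff ((n : ℝ) + 1) ξ * uI₁ ξ) ^ 2 := integral_nonneg fun ξ => by positivity
    nlinarith [mul_le_mul_of_nonneg_left hplatR hκ.le, mul_le_mul_of_nonneg_left hplatI hκ.le, mul_nonneg hκ.le hnnR,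
      mul_nonneg hκ.le hnnI]
  have hlim : Tendsto (fun n : ℕ => (κ / 4 + C) * (TR n + TI n)) atTop (𝓝 ((κ / 4 + C) * (0 + 0))) :=
    ((tendsto_tail h0R).add (tendsto_tail h0I)).const_mul _
  rw [add_zero, mul_zero] at hlim
  have hmain : κ / 4 * (IR + II) ≤ 0 := ge_of_tendsto' hlim hstep
  have hIRnn : 0 ≤ IR := integral_nonneg fun ξ => by positivity
  have hIInn : 0 ≤ II := integral_nonneg fun ξ => by positivity
  have hIR0 : IR = 0 := by nlinarith
  have hII0 : II = 0 := by nlinarith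
  exact ⟨eq_zero_of_weightedSq_eq_zero hL huRc h0R hIR0, eq_zero_of_weightedSq_eq_zero hL huIc h0I hII0⟩

end Pair

end SheetRLinearisedCutoffEnergy
end Summit.NavierStokesRegularity.OSWSelfSimilar

end
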